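import Mathlib
import HarnessLib
import Summits.CriticalPhenomena.Ising3DConformalLimit.Theses.PrecisionLaplacian
import Literature.Probability.LatticeModels.AxisSpectralRepresentation

/-!
# Sketch — first lemmas of the crux-idea cards for `DirectCorrelationStableTail`
(stmt-CriticalPhenomena-4799, route PrecisionLaplacian).  Statements only (Props); nothing is proved
here except trivial shape checks.  `a` = the direct correlation function exactly as inlined in the
route file (iInf over finite sets of a `Matrix.inv` entry of the critical kernel).
-/

noncomputable section

namespace Summit.CriticalPhenomena.Ising3DConformalLimit.Cruxes.DirectCorrelationStableTail.Sketch

open MeasureTheory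
open Literature.Probability.LatticeModels

/-- the critical kernel `G_A = (⟨σ_p σ_q⟩_{β_c(3)})_{p,q ∈ A}` on a finite `A ⊂ ℤ³` (as in the route). -/
abbrev GA (A : Finset (Site 3)) : Matrix ↥A ↥A ℝ :=
  Matrix.of fun (p q : ↥A) => criticalTwoPoint 3 (q.1 - p.1)

/-- the symmetric-potential hypothesis of the crux (conclusion of `InverseMCriticalKernel`), verbatim. -/
def SymmPotential : Prop :=
  ∀ A : Finset (Site 3), (GA A).PosDef ∧
    ∀ u v : ↥A, (u ≠ v → (GA A)⁻¹ u v ≤ 0) ∧ 0 ≤ ∑ w, (GA A)⁻¹ u w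

/-- the direct correlation function `a(x) = inf_{A ∋ 0,x} −(G_A)⁻¹(0,x)` (route's inlined object). -/
def dcf (x : Site 3) : ℝ :=
  ⨅ A : {A : Finset (Site 3) // (0 : Site 3) ∈ A ∧ x ∈ A}, -((GA A.1)⁻¹ ⟨0, A.2.1⟩ ⟨x, A.2.2⟩)

/-- slab sum in the first lattice direction: `S(n) = Σ_{x⊥ ∈ ℤ²} a(n, x⊥)`. -/
def slabSum (n : ℤ) : ℝ :=
  ∑' y : Fin 2 → ℤ, dcf (Fin.cons n y)

/-- slab Fourier mode `â_n(k⊥) = Σ_{x⊥ ∈ ℤ²} a(n, x⊥) cos(k⊥ · x⊥)`. -/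
def slabMode (n : ℤ) (k : Fin 2 → ℝ) : ℝ :=
  ∑' y : Fin 2 → ℤ, dcf (Fin.cons n y) * Real.cos (∑ i, k i * (y i : ℝ))

/-! ## Card `self-energy-pick-inversion` — first lemma

Reflection positivity of the critical state in the (site and bond) mirrors orthogonal to `e₁` makes
`z = cos k₁ ↦ Ĝ(k₁,k⊥)` a Pick function `c₀ + ∫_{(1,∞)} dν_{k⊥}(s)/(s−z)`; the Pick class is closed
under `F ↦ −1/F`, so `ψ = 1/Ĝ = A₀ − â` has non-positive Chebyshev coefficients of every order `≥ 2`,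
with the Hausdorff-moment structure `â_n(k⊥) = ∫ λ(s)ⁿ (s²−1)^{-1/2} dτ_{k⊥}(s)`, `λ(s) = s − √(s²−1)`.
Input: the `ℓ²(ℤ^{d−1})` form of Aizenman–Duminil-Copin 2021 Prop. 8.6 (tree: axis case
`AizenmanDuminilCopin2021_prop_8_6`), plus `SymmPotential` + summability only to identify `â` with the
route's object `a`. -/

/-- FIRST LEMMA (checkable statement): off the unit slab, the transverse Fourier modes of the direct
correlation function are Hausdorff moment sequences in the longitudinal variable. -/
def SlabModesHausdorff : Prop :=
  SymmPotential → Summable dcf →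
    ∀ k : Fin 2 → ℝ, ∃ τ : Measure ℝ, IsFiniteMeasure τ ∧ τ (Set.Icc (0 : ℝ) 1)ᶜ = 0 ∧
      ∀ n : ℕ, 2 ≤ n → slabMode (n : ℤ) k = ∫ t, t ^ n ∂τ

/-- measure-free corollary: complete monotonicity of the slab sums `S(n)`, `n ≥ 2`, as iterated
finite differences `Σ_j (−1)^j (m choose j) S(n+j) ≥ 0`. -/
def SlabSumsCompletelyMonotone : Prop :=
  SymmPotential → Summable dcf →
    ∀ n m : ℕ, 2 ≤ n →
      0 ≤ ∑ j ∈ Finset.range (m + 1), (-1 : ℝ) ^ j * (m.choose j : ℝ) * slabSum ((n + j : ℕ) : ℤ)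

/-- axial domination (consequence of `SlabModesHausdorff` at order 0 in `k⊥` + pointwise `a ≥ 0`):
inside each slab `{x₁ = n}`, `n ≥ 2`, the axis point carries the maximum of `a`. -/
def AxialDomination : Prop :=
  SymmPotential → Summable dcf →
    ∀ (n : ℤ) (y : Fin 2 → ℤ), 2 ≤ n → |dcf (Fin.cons n y)| ≤ dcf (Fin.cons n 0)

/-- two-sided Kaluza (pure analysis, support fact behind the card; the collinear case of the
inverse-M hypothesis for free): a symmetric Toeplitz kernel on `ℤ` with completely monotone symbol
`g(|n|) = ∫ λ^{|n|} dM(λ)`, `M ≥ 0` finite on `[0,1)`, is a symmetric potential on every finite set. -/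
def TwoSidedKaluza : Prop :=
  ∀ (M : Measure ℝ), IsFiniteMeasure M → M (Set.Ico (0 : ℝ) 1)ᶜ = 0 → M ≠ 0 →
    ∀ A : Finset ℤ,
      (Matrix.of fun (i j : ↥A) => ∫ t, t ^ (i.1 - j.1).natAbs ∂M).PosDef ∧
      ∀ u v : ↥A, (u ≠ v → (Matrix.of fun (i j : ↥A) => ∫ t, t ^ (i.1 - j.1).natAbs ∂M)⁻¹ u v ≤ 0) ∧
        0 ≤ ∑ w, (Matrix.of fun (i j : ↥A) => ∫ t, t ^ (i.1 - j.1).natAbs ∂M)⁻¹ u w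

/-- TORUS FORM of the first lemma (fully finite; provable now from the tree's PROVED transfer
positivity `exists_spectralProfile` in `TorusTransferSpectral.lean` + Pick inversion of a finite atomic
Cauchy transform + aliasing of Chebyshev coefficients): for the n.n. Ising model on `(ℤ/N)³`, `N ≥ 4`,
every `β ≥ 0`, zero field, with `Σ_{xy} = ⟨σ_x σ_y⟩` and `a_N := −Σ⁻¹(0,·)`, the transverse Fourier modes of
`a_N` in the slabs `2 ≤ n ≤ N − 2` are non-negative (no inverse-M hypothesis; this is what the kit tube jobs
test numerically). -/
def TorusSlabModesNonneg : Prop :=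
  ∀ (N : ℕ) [NeZero N] (β : ℝ), 4 ≤ N → 0 ≤ β →
    ∀ (n : ZMod N) (k : Fin 2 → ZMod N), 2 ≤ n.val → n.val ≤ N - 2 →
      0 ≤ ∑ y : Fin 2 → ZMod N,
        (-((Matrix.of fun (x z : TorusSite 3 N) => isingTorusTwoPoint 3 N β 0 x z)⁻¹ 0 (Fin.cons n y)))
          * Real.cos (∑ i, 2 * Real.pi * ((k i).val : ℝ) * ((y i).val : ℝ) / N)

/-! ## Card `nine-cone-symbol-calculus` — first lemma

Pure longitudinal differences of the critical two-point function are controlled, to every order, by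
the axis value at half the distance: from the `ℓ²` spectral representation (transfer positivity,
Cauchy–Schwarz between the measures `μ_{δ₀}` and `μ_{δ_{x⊥}}`) and
`sup_{λ∈[0,1]} λ^{⌈n/2⌉}(1−λ)^N ≤ (2N/n)^N`. -/

/-- forward difference in the first lattice direction. -/
def fwdDiff (f : Site 3 → ℝ) (x : Site 3) : ℝ :=
  f (x + Pi.single 0 1) - f x

/-- FIRST LEMMA (checkable statement, provable now from ADC 2021 Prop. 8.6 in its printed `ℓ²` form):
axial-cone symbol bound of all orders for the critical two-point function on `ℤ³`. -/
def AxialConeSymbolBound : Prop :=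
  ∀ N : ℕ, ∃ C : ℝ, ∀ x : Site 3, 1 ≤ x 0 →
    |(fwdDiff^[N] (criticalTwoPoint 3)) x|
      ≤ C / ((x 0 : ℝ) ^ N) * criticalTwoPoint 3 (Pi.single 0 (x 0 / 2))

/-- Pruitt's function of the direct correlation function, `h(r) = Σ_x a(x) min(1, r²‖x‖²)`
(under `SymmPotential`, `ψ(k) = 1/Ĝ(k) ≍ h(‖k‖)` two-sidedly: IM makes `1/Ĝ` elliptic). -/
def pruitt (r : ℝ) : ℝ :=
  ∑' x : Site 3, dcf x * min 1 (r ^ 2 * ‖x‖ ^ 2)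

/-- the card's target shape (conditional; the hypothesis `hcone` stands for the nine-cone symbol bounds
of `G`, whose `e₁`-instance is `AxialConeSymbolBound`): a pointwise envelope for `a` in ALL directions
at the size dictated by `h`, which turns measure-level regular variation into the pointwise TAIL. -/
def PointwiseEnvelopeShape (hcone : Prop) : Prop :=
  SymmPotential → Summable dcf → hcone →
    ∃ C : ℝ, ∀ x : Site 3, x ≠ 0 → |dcf x| ≤ C * ‖x‖ ^ (-(3 : ℝ)) * pruitt (1 / ‖x‖)

/-- shape check only: the crux decl is in scope and the sketch's hypothesis is literally its antecedent. -/
example (h : Summit.CriticalPhenomena.Ising3DConformalLimit.Theses.PrecisionLaplacian.DirectCorrelationStableTail)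
    (hp : SymmPotential) :
    ∃ (η : ℝ) (Φ : (Fin 3 → ℝ) → ℝ), 0 < η ∧ η < 1 ∧ ContinuousOn Φ {u | ∑ i, u i ^ 2 = 1} ∧
      (∀ u : Fin 3 → ℝ, ∑ i, u i ^ 2 = 1 → 0 ≤ Φ u) ∧ (∃ u : Fin 3 → ℝ, ∑ i, u i ^ 2 = 1 ∧ 0 < Φ u) ∧
      Filter.Tendsto (fun x : Site 3 => dcf x * Real.sqrt (∑ j, ((x j : ℝ)) ^ 2) ^ (5 - η)
        - Φ (fun i => (x i : ℝ) / Real.sqrt (∑ j, ((x j : ℝ)) ^ 2))) Filter.cofinite (nhds 0) :=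
  h hp

end Summit.CriticalPhenomena.Ising3DConformalLimit.Cruxes.DirectCorrelationStableTail.Sketch

end
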